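import Summits.BirchSwinnertonDyer.BirchSwinnertonDyer.Theses.RamifiedSevenEllipticUnits
import Literature.NumberTheory.EllipticCurves.LocalPointsIntegersSubgroup
import Summits.BirchSwinnertonDyer.Rank1Residual.X11b.LocalPrimaryFinite
import Literature.NumberTheory.EllipticCurves.SelmerPInftyRestriction
import Literature.NumberTheory.EllipticCurves.StrictSelmerRankOne
import Literature.NumberTheory.EllipticCurves.PointDivisibilityProofs
import Literature.NumberTheory.EllipticCurves.BSDSelmer
import HarnessLib

set_option linter.dupNamespace false
set_option autoImplicit false

/-!
# Route `RamifiedSevenEllipticUnits` (rung K7r), crux `StrictControlSeven` (stmt-BirchSwinnertonDyer-19145):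
# KUMMER VANISHING AWAY FROM `p` — at a finite place `v ∤ p` the classical `p^∞`-Selmer local
# condition IS local triviality in `H¹(K_v, E[p^∞])` (first brick of the twist-descent step)

Cell `bsd-cm`, seat `bsd-cm-k7r-c4` (g0). HONEST FRAMING: nothing here closes the crux; BSD is not
proved by any of this. By the seat's `…StrictControlDescent`, crux #4 is the identity
`log₇ #Sel_𝔭(K, E[7^∞]) = log₇ #Sel_str(W/ℚ)[7^∞] + log₇ #Sel_str(W'/ℚ)[7^∞]`, whose two sides are
written with DIFFERENT local conditions off `7`: Castella's group (left) asks local TRIVIALITY in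
`H¹(K_v, E[7^∞])`, the strict Selmer groups (right, `strictSelmerPInfty = selmerGroupPInfty ⊓ …`) ask
the classical condition "dies in `H¹(ℚ_v, E)`". This file proves, for EVERY elliptic curve over a
number field, every prime `p` and every finite place `v ∤ p`, that the two conditions coincide.

## What is proved (all for `W` elliptic over a number field `K`, `p` prime, `v` finite, `v ∤ p`)

* `exists_eq_pow_nsmul_add_of_not_mem` — **`E(K_v) = p^N E(K_v) + E(K_v)_tors`** for every `N`: from
  Silverman VII.6.3 in the tree's form (`exists_finiteIndex_torsionFree_adicCompletion`: a finite-index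
  torsion-free `U ≤ E(K_v)` with `[U : nU] = (𝒪_v : n𝒪_v)`, which is `1` for `n = p^N`, `v ∤ p`).
* `kummerMapLevel_baseChange_adicCompletion_eq_zero` — every level-`N` Kummer class of `E/K_v` in
  `H¹(K_v, E[p^∞])` vanishes (`κ_N(p^N Q) = 0`, `κ_N(t) = 0` for torsion `t`); i.e. `E(K_v) ⊗ ℚ_p/ℤ_p = 0`.
* `ker_primaryH1ToH1_baseChange_adicCompletion_eq_bot` — **`H¹(K_v, E[p^∞]) → H¹(K_v, E)` is
  injective** (Kummer exactness `range_kummerMapPInfty` over the perfect field `K_v`).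
* `resPrimary_eq_zero_iff_mem_selmerLocalKerPrimaryTorsion` — bookkeeping: the kernel of the tree's
  restriction `resPrimary W L p : H¹(K, E[p^∞]) → H¹(L, E_L[p^∞])` is the local kernel
  `selmerLocalKerPrimaryTorsion W L p` (any `K`-field `L`; coefficients identified by
  `localPointsEquivGeomPoints`).
* **`selmerLocalKerPrimary_adicCompletion_eq_of_not_mem`** — for `v ∤ p`:
  `selmerLocalKerPrimary W (K_v) p = selmerLocalKerPrimaryTorsion W (K_v) p`.

References: [SilvermanAEC2009] Prop. VII.6.3, VIII.§2, X.§4; [MilneADT2006] I Lemma 3.3, I.§6;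
[GreenbergLNM1716] §2 pp. 62–63 ("`Im(κ_v) = 0` for `v ∤ p`").
-/

noncomputable section

open scoped Classical

open WeierstrassCurve NumberField IsDedekindDomain Field
  Literature.NumberTheory.EllipticCurves
  Literature.NumberTheory.GaloisRepresentations

universe u

namespace Summit.BirchSwinnertonDyer.BirchSwinnertonDyer.Theorems.RamifiedSevenEllipticUnits

/-! ## §1 `E(K_v) = p^N E(K_v) + E(K_v)_tors` for `v ∤ p` -/

section Structure

variable {K : Type u} [Field K] [NumberField K] (W : WeierstrassCurve K) [W.IsElliptic]
  (v : HeightOneSpectrum (𝓞 K)) {p : ℕ}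

/-- **`E(K_v) = p^N E(K_v) + E(K_v)_tors` at `v ∤ p`.** Every `K_v`-point is `p^N Q + t` with `t` of
finite order: take Silverman VII.6.3's torsion-free finite-index `U ≤ E(K_v)` (tree
`exists_finiteIndex_torsionFree_adicCompletion`); `[U : p^M U] = (𝒪_v : p^M 𝒪_v) = 1`, so `U` is
`p`-divisible; with `m = [E(K_v) : U] = p^a m'`, `p ∤ m'`, `m P = p^{a+N} u` gives
`m' P = p^N u + t₀` with `p^a t₀ = 0`, and Bézout `x m' + y p^N = 1` finishes.
[cite: SilvermanAEC2009, Prop. VII.6.3] [cite: MilneADT2006, I Lemma 3.3] -/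
theorem exists_eq_pow_nsmul_add_of_not_mem [hp : Fact p.Prime] (hpv : (p : 𝓞 K) ∉ v.asIdeal)
    (N : ℕ) (P : (W.baseChange (v.adicCompletion K)).toAffine.Point) :
    ∃ (Q t : (W.baseChange (v.adicCompletion K)).toAffine.Point),
      IsOfFinAddOrder t ∧ P = p ^ N • Q + t := by
  obtain ⟨U, hfi, htf, hidx⟩ := W.exists_finiteIndex_torsionFree_adicCompletion (v := v)
  haveI := hfi
  -- `U` is `p^M`-divisible for every `M`
  have hdivU : ∀ (M : ℕ) (u : (W.baseChange (v.adicCompletion K)).toAffine.Point), u ∈ U →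
      ∃ u' ∈ U, p ^ M • u' = u := by
    intro M u hu
    have h1 : (U.map (nsmulAddMonoidHom (p ^ M) : _ →+ _)).relIndex U = 1 := by
      rw [hidx (p ^ M) (pow_ne_zero M hp.out.ne_zero),
        Summit.BirchSwinnertonDyer.Rank1Residual.X11b.LocBridge.natCard_quotient_span_pow_eq_one (p := p) (v := v) hpv M]
    obtain ⟨u', hu', rfl⟩ := (AddSubgroup.relIndex_eq_one.mp h1) hu
    exact ⟨u', hu', rfl⟩
  -- `m = [E(K_v) : U] = p^a · m'`, `p ∤ m'`
  set m := U.index with hm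
  have hm0 : m ≠ 0 := AddSubgroup.FiniteIndex.index_ne_zero
  obtain ⟨a, m', hm', hmeq⟩ := Nat.exists_eq_pow_mul_and_not_dvd hm0 p hp.out.ne_one
  have hmP : m • P ∈ U := U.nsmul_index_mem P
  obtain ⟨u, hu, hu'⟩ := hdivU (a + N) (m • P) hmP
  -- `t₀ := m' P - p^N u` is killed by `p^a`
  set t₀ := m' • P - p ^ N • u with ht₀
  have ht₀tors : p ^ a • t₀ = 0 := by
    rw [ht₀, smul_sub, ← mul_nsmul', ← hmeq, ← mul_nsmul', ← pow_add, hu', sub_self]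
  have ht₀fin : IsOfFinAddOrder t₀ :=
    isOfFinAddOrder_iff_nsmul_eq_zero.mpr ⟨p ^ a, pow_pos hp.out.pos a, ht₀tors⟩
  -- Bézout: `m'` and `p^N` are coprime
  have hcop : Nat.Coprime m' (p ^ N) :=
    Nat.Coprime.pow_right N ((Nat.Prime.coprime_iff_not_dvd hp.out).mpr hm').symm
  obtain ⟨x, y, hxy⟩ : IsCoprime (m' : ℤ) ((p ^ N : ℕ) : ℤ) := Nat.isCoprime_iff_coprime.mpr hcop
  refine ⟨x • u + y • P, x • t₀, ht₀fin.zsmul, ?_⟩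
  have hm'P : (m' : ℤ) • P = p ^ N • u + t₀ := by
    rw [ht₀, natCast_zsmul, add_sub_cancel]
  have h1 : P = x • ((m' : ℤ) • P) + y • (((p ^ N : ℕ) : ℤ) • P) := by
    rw [smul_smul, smul_smul, ← add_smul, hxy, one_smul]
  calc P = x • ((m' : ℤ) • P) + y • (((p ^ N : ℕ) : ℤ) • P) := h1
    _ = x • (p ^ N • u + t₀) + y • (p ^ N • P) := by rw [hm'P, natCast_zsmul]
    _ = p ^ N • (x • u + y • P) + x • t₀ := by
        rw [smul_add, smul_add, smul_comm x (p ^ N) u, smul_comm y (p ^ N) P]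
        abel

end Structure

/-! ## §2 `E(K_v) ⊗ ℚ_p/ℤ_p = 0` and `H¹(K_v, E[p^∞]) ↪ H¹(K_v, E)` for `v ∤ p` -/

section Kummer

variable {K : Type u} [Field K] [NumberField K] (W : WeierstrassCurve K) [W.IsElliptic]
  (v : HeightOneSpectrum (𝓞 K)) (p : ℕ) [hp : Fact p.Prime]

/-- **Every Kummer class of `E/K_v` in `H¹(K_v, E[p^∞])` vanishes at `v ∤ p`**: `P = p^N Q + t`
(§1), `κ_N(p^N Q) = 0` (`kummerMapLevel_nsmul_self`) and `κ_N(t) = 0` for torsion `t`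
(`kummerMapLevel_eq_zero_of_isOfFinAddOrder`). Greenberg: "`Im(κ_v) = 0` since `E(K_v) ⊗ ℚ_p/ℤ_p = 0`
for `v ∤ p`". [cite: GreenbergLNM1716, §2 pp. 62–63] [cite: SilvermanAEC2009, VIII.§2] -/
theorem kummerMapLevel_baseChange_adicCompletion_eq_zero (hpv : (p : 𝓞 K) ∉ v.asIdeal)
    [(W.baseChange (v.adicCompletion K)).IsElliptic] (N : ℕ)
    (P : (W.baseChange (v.adicCompletion K)).toAffine.Point) :
    kummerMapLevel (W.baseChange (v.adicCompletion K)) p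
      (W.baseChange (v.adicCompletion K)).zsmul_geomPoints_surjective_holds N P = 0 := by
  obtain ⟨Q, t, ht, rfl⟩ := exists_eq_pow_nsmul_add_of_not_mem W v hpv N P
  rw [map_add, kummerMapLevel_nsmul_self,
    kummerMapLevel_eq_zero_of_isOfFinAddOrder _ p _ N ht, add_zero]

/-- **`H¹(K_v, E[p^∞]) → H¹(K_v, E)` is injective at `v ∤ p`**: its kernel is the image of the
`p^∞` Kummer map (`range_kummerMapPInfty`, `K_v` perfect), which vanishes
(`kummerMapLevel_baseChange_adicCompletion_eq_zero`). [cite: GreenbergLNM1716, §2 pp. 62–63] [cite: MilneADT2006, I.§6] -/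
theorem ker_primaryH1ToH1_baseChange_adicCompletion_eq_bot (hpv : (p : 𝓞 K) ∉ v.asIdeal) :
    (primaryH1ToH1 (W.baseChange (v.adicCompletion K)) p).ker = ⊥ := by
  haveI : (W.baseChange (v.adicCompletion K)).IsElliptic := by rw [baseChange]; infer_instance
  haveI : CharZero (v.adicCompletion K) := charZero_adicCompletion v
  rw [← range_kummerMapPInfty (W.baseChange (v.adicCompletion K)) p
    (W.baseChange (v.adicCompletion K)).zsmul_geomPoints_surjective_holds, eq_bot_iff]
  rintro _ ⟨t, rfl⟩
  obtain ⟨P, N, rfl⟩ := exists_eq_tmul_prufGen (W.baseChange (v.adicCompletion K)) p t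
  rw [AddSubgroup.mem_bot, kummerMapPInfty_tmul_prufGen,
    kummerMapLevel_baseChange_adicCompletion_eq_zero W v p hpv]

end Kummer

/-! ## §3 The kernel of `resPrimary` is the local kernel `selmerLocalKerPrimaryTorsion` -/

section ResPrimary

variable {K : Type u} [Field K] (W : WeierstrassCurve K) (L : Type u) [Field L] [Algebra K L]
  (p : ℕ)

/-- The coefficient identification `E(L̄)[p^∞] ≃+ E_L[p^∞]` (restriction of
`localPointsEquivGeomPoints` to `p`-primary parts), packaged. [folklore] -/
theorem exists_primaryLocalPointsEquiv :
    ∃ θ : AddCommGroup.primaryComponent (localPoints W L) p ≃+ geomPrimaryTorsion (W.baseChange L) p,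
      (∀ (σ : absoluteGaloisGroup L) (m : AddCommGroup.primaryComponent (localPoints W L) p),
        θ (σ • m) = σ • θ m) ∧
      ∀ m : W.geomPrimaryTorsion p, θ (primaryPointsMap W L p m) = primaryBaseChangeMap W L p m := by
  let e : localPoints W L ≃+ geomPoints (W.baseChange L) := localPointsEquivGeomPoints W L
  let f : AddCommGroup.primaryComponent (localPoints W L) p →+ geomPrimaryTorsion (W.baseChange L) p :=
    ((e : localPoints W L →+ geomPoints (W.baseChange L)).comp
      (AddCommGroup.primaryComponent (localPoints W L) p).subtype).codRestrict _ fun P ↦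
        map_mem_primaryComponent (e : localPoints W L →+ geomPoints (W.baseChange L)) P.2
  have hf_inj : Function.Injective f := by
    intro P Q h
    apply Subtype.ext
    apply e.injective
    exact congrArg (fun x : geomPrimaryTorsion (W.baseChange L) p ↦ (x : geomPoints (W.baseChange L))) h
  have hf_surj : Function.Surjective f := by
    rintro ⟨Q, hQ⟩
    refine ⟨⟨e.symm Q, by
      obtain ⟨k, hk⟩ := AddCommGroup.mem_primaryComponent.mp hQ
      exact AddCommGroup.mem_primaryComponent.mpr ⟨k, by rw [← map_nsmul, hk, map_zero]⟩⟩, ?_⟩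
    apply Subtype.ext
    change e (e.symm Q) = Q
    exact e.apply_symm_apply Q
  refine ⟨AddEquiv.ofBijective f ⟨hf_inj, hf_surj⟩, fun σ m ↦ ?_, fun m ↦ ?_⟩
  · apply Subtype.ext
    change e (σ • (m : localPoints W L)) = σ • e (m : localPoints W L)
    exact localPointsEquivGeomPoints_smul W L σ m
  · apply Subtype.ext
    rfl

/-- **`resPrimary W L p c = 0 ↔ c ∈ selmerLocalKerPrimaryTorsion W L p`**: both maps are restriction
along `Γ_L → Γ_K` with coefficients `E[p^∞] → E(L̄)[p^∞]`, `resPrimary` followed by the coefficient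
isomorphism `E(L̄)[p^∞] ≃ E_L[p^∞]` (an isomorphism on `H¹`). [cite: SerreGaloisCohomology1997, I.§2.4] -/
theorem resPrimary_eq_zero_iff_mem_selmerLocalKerPrimaryTorsion (c : galH1Primary W p) :
    resPrimary W L p c = 0 ↔ c ∈ selmerLocalKerPrimaryTorsion W L p := by
  obtain ⟨θ, hθ, hsq⟩ := exists_primaryLocalPointsEquiv W L p
  have key : resPrimary W L p c =
      h1Equiv θ hθ (resH1Hom (resGal (K := K) L) (primaryPointsMap W L p)
        (primaryPointsMap_smul W L p) c) := by
    rw [h1Equiv_apply, resH1Hom_resH1Hom, resPrimary]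
    refine congrFun (congrArg DFunLike.coe (resH1Hom_congr (by ext; rfl) ?_ _ _)) c
    exact AddMonoidHom.ext fun m ↦ (hsq m).symm
  rw [key, AddEquiv.map_eq_zero_iff, selmerLocalKerPrimaryTorsion, resKer_eq_ker, AddMonoidHom.mem_ker]

/-- `selmerLocalKerPrimaryTorsion ≤ selmerLocalKerPrimary` (a class dying in `H¹(L, E(L̄)[p^∞])`
dies in `H¹(L, E(L̄))`): through `resPrimary = 0 ⟹ res (E[p^∞] ↪ E)_* = 0`
(`primaryH1ToH1_resPrimary`, `mem_ker_resBaseChange_iff`, `selmerLocalKerPrimary_eq_comap`).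
[cite: GreenbergLNM1716, §2 p. 63] -/
theorem selmerLocalKerPrimaryTorsion_le_selmerLocalKerPrimary :
    selmerLocalKerPrimaryTorsion W L p ≤ selmerLocalKerPrimary W L p := by
  intro c hc
  rw [selmerLocalKerPrimary_eq_comap, AddSubgroup.mem_comap, ← mem_ker_resBaseChange_iff,
    ← primaryH1ToH1_resPrimary,
    (resPrimary_eq_zero_iff_mem_selmerLocalKerPrimaryTorsion W L p c).mpr hc, map_zero]

end ResPrimary

/-! ## §4 At `v ∤ p` the classical `p^∞`-Selmer local condition is local triviality -/

section Away

variable {K : Type u} [Field K] [NumberField K] (W : WeierstrassCurve K) [W.IsElliptic]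
  (v : HeightOneSpectrum (𝓞 K)) (p : ℕ) [hp : Fact p.Prime]

/-- **KUMMER VANISHING AT `v ∤ p`: `ker (H¹(K, E[p^∞]) → H¹(K_v, E)) = ker (H¹(K, E[p^∞]) →
H¹(K_v, E(K̄_v)[p^∞]))`** — the classical `p^∞`-Selmer local condition at a finite place `v ∤ p`
(Greenberg's `Im(κ_v) = 0`, `Sel` condition "`c_v ∈ Im(κ_v)`") is local TRIVIALITY of the class in
`H¹(K_v, E[p^∞])`. For `E` elliptic over any number field `K`, every prime `p`, every `v ∤ p`.
(`⊇` always; `⊆`: `H¹(K_v, E[p^∞]) ↪ H¹(K_v, E)` by §2.) This identifies, place by place off `p`,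
the local conditions of the classical strict Selmer groups with those of Castella's everywhere-
locally-trivial group `Sel_𝔭(K, E[p^∞])` (sibling cell X11b, flag `JSW-331-Kinf-formulation`).
[cite: GreenbergLNM1716, §2 pp. 62–63] [cite: MilneADT2006, I Lemma 3.3 and I.§6] -/
theorem selmerLocalKerPrimary_adicCompletion_eq_of_not_mem (hpv : (p : 𝓞 K) ∉ v.asIdeal) :
    selmerLocalKerPrimary W (v.adicCompletion K) p =
      selmerLocalKerPrimaryTorsion W (v.adicCompletion K) p := by
  refine le_antisymm (fun c hc ↦ ?_)
    (selmerLocalKerPrimaryTorsion_le_selmerLocalKerPrimary W (v.adicCompletion K) p)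
  rw [selmerLocalKerPrimary_eq_comap, AddSubgroup.mem_comap, ← mem_ker_resBaseChange_iff,
    ← primaryH1ToH1_resPrimary, ← AddMonoidHom.mem_ker,
    ker_primaryH1ToH1_baseChange_adicCompletion_eq_bot W v p hpv, AddSubgroup.mem_bot] at hc
  exact (resPrimary_eq_zero_iff_mem_selmerLocalKerPrimaryTorsion W (v.adicCompletion K) p c).mp hc

end Away

end Summit.BirchSwinnertonDyer.BirchSwinnertonDyer.Theorems.RamifiedSevenEllipticUnits

end
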